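import Literature.NumberTheory.LFunctions.FeketePolyaKernelCertificates
import Literature.NumberTheory.LFunctions.FeketePolyaTablesSequential
import Literature.NumberTheory.LFunctions.NoRealZeroOddSmallModuliII
import HarnessLib

/-!
# Fekete–Pólya certificates of every order through induced characters, list-free, for large conductors

Topic `Literature/NumberTheory/LFunctions`; namespace `Literature.NumberTheory.LFunctions.FeketePolyaKernel`
(sequel of `FeketePolyaKernelCertificates.lean`). Small computable definitions and THEOREMS (no named fact,
no `sorry`): the engine of the Fekete–Pólya lane of the kernel floor (cell `parity-realchar`) for conductors
`q` in the thousands, where the value TABLES of `FeketePolyaTablesSequential.lean` (a `q`-entry literal list per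
character, identified entry by entry) are out of reach.

* `run4` / `run12` — the sequential walk of `FeketePolyaTable.seqWalk` at orders `4` and `12` with the
  accumulators as ARGUMENTS (a list state costs ten times more per step in the kernel), GENERIC in the value
  function `x : ℕ → ℤ` of the induced character (here computed, never tabulated), every accumulator re-matched
  against a numeral pattern at every step (`force1`: this keeps the kernel's integer terms literal — without it
  the un-normalised `Int.ofNat (_ + _)` payloads of sign-stable accumulators pile up and a walk of `10⁵` steps at
  order `8` exhausts the checker); `run4_eq_seqWalk` / `run12_eq_seqWalk`: on a table's values they ARE `seqWalk`,
  so the soundness of the table engine (`FeketePolyaTable.ipsum_nonneg_of_seqCheck`, MV §11.2.1 Exercise 7 (f):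
  one period suffices at every order; `FeketePolya1912_holds`; descent from `χ↑m` to `χ` by the positive Euler
  factors, Chowla / Exercise 8) is inherited through the SPECIFICATION table `(List.range q).map v` (never
  evaluated). Positivity at order `k` over a period implies positivity at every order `≥ k`, so two walks serve
  every witness `k ≤ 12` (`fpOrder`).
* `pack v q` / `look T q n` — the period of `v` packed two bits per entry into ONE numeral
  `T = ∑_{r<q} code(v r)·4^r` (built once, `q` evaluations of `v`), read back by the shift `(T >>> 2(n mod q)) mod 4` (kernel
  bignum arithmetic, linear in `q`); `look_pack`. Along an induced modulus `q·w` with `w ≥ 2` this replaces `q·w` evaluations of the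
  binary Jacobi algorithm by `q` (measured on the farm, `q = 6007`: `1.7 ms` per Jacobi value against `0.25 ms`
  per packed step).
* `fpVal`, `fpRun v q w k` — the certificate: order `k` along `χ↑(q·w)`, values direct for `w = 1`, packed for
  `w ≥ 2`; `lfunction_ne_zero_of_fpRun` — the engine; `good_{odd,even}_of_{odd,four,eight}_fp` — the
  per-conductor wrappers keyed on `q` alone (statement shape of the `interval_cases` bullets of the
  `NoRealZero{Odd,Even}…` range files), parity test or certificate.

## References

* H. L. Montgomery, R. C. Vaughan, *Multiplicative Number Theory I*, CUP 2007, §9.3 Thm 9.13, §11.2.1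
  Exercises 7–8. [MontgomeryVaughan2007]
* M. Fekete, G. Pólya, *Über ein Problem von Laguerre*, Rend. Circ. Mat. Palermo 34 (1912) 89–120.
  [FeketePolya1912]
* S. Chowla, *Note on Dirichlet's `L`-functions*, Acta Arith. 1 (1935) 113–114. [Chowla1935]
* J. B. Rosser, *Real roots of real Dirichlet L-series*, J. Res. NBS 45 (1950) 505–514. [Rosser1950RealRoots]
-/

namespace Literature.NumberTheory.LFunctions

namespace FeketePolyaKernel

open Literature.Barriers.RiemannHypothesis PrimitiveQuadratic FeketePolyaTable SmallModuli OddSmallModuliII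
open scoped NumberTheorySymbols

/-! ### The walks of order `4` and `12` (accumulators as arguments, re-normalised at every step) -/

/-- Re-match an integer against a numeral pattern (forces the kernel to normalise its `Nat` payload; the
value is always `true`, `force1_eq_true`). [folklore] -/
def force1 : ℤ → Bool
  | Int.ofNat 0 => true
  | Int.ofNat (_ + 1) => true
  | Int.negSucc 0 => true
  | Int.negSucc (_ + 1) => true

/-- `force1 y = true`. [folklore] -/
@[simp] private theorem force1_eq_true (y : ℤ) : force1 y = true := by
  rcases y with (_ | _) | (_ | _) <;> rfl

/-- **Order-`4` walk**, generic in the values `x` of the induced character: from the state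
`(S_1(n), …, S_4(n))` process positions `n+1, …, n+fuel`, failing as soon as `S_4 < 0`, and test
`S_1, …, S_4 ≥ 0` at the end — `FeketePolyaTable.seqWalk` on four accumulators (`run4_eq_seqWalk`), with every
accumulator re-normalised at every step. [cite: MontgomeryVaughan2007, §11.2.1 Exercise 7 (f)] -/
def run4 (x : ℕ → ℤ) : ℕ → ℕ → ℤ → ℤ → ℤ → ℤ → Bool
  | 0, _, s₁, s₂, s₃, s₄ => decide (0 ≤ s₁) && (decide (0 ≤ s₂) && (decide (0 ≤ s₃) && (decide (0 ≤ s₄) && true)))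
  | fuel + 1, n, s₁, s₂, s₃, s₄ =>
    let y₁ := s₁ + x (n + 1)
    let y₂ := s₂ + y₁
    let y₃ := s₃ + y₂
    let y₄ := s₄ + y₃
    bif force1 y₁ && force1 y₂ && force1 y₃ then
      match y₄ with
      | Int.negSucc _ => false
      | Int.ofNat _ =>
        match n + 1 with
        | 0 => false
        | n' + 1 => run4 x fuel (n' + 1) y₁ y₂ y₃ y₄
    else false

/-- **Order-`12` walk**, as `run4` with twelve accumulators (`run12_eq_seqWalk`).
[cite: MontgomeryVaughan2007, §11.2.1 Exercise 7 (f)] -/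
def run12 (x : ℕ → ℤ) : ℕ → ℕ → ℤ → ℤ → ℤ → ℤ → ℤ → ℤ → ℤ → ℤ → ℤ → ℤ → ℤ → ℤ → Bool
  | 0, _, s₁, s₂, s₃, s₄, s₅, s₆, s₇, s₈, s₉, s₁₀, s₁₁, s₁₂ =>
    decide (0 ≤ s₁) && (decide (0 ≤ s₂) && (decide (0 ≤ s₃) && (decide (0 ≤ s₄) && (decide (0 ≤ s₅) &&
      (decide (0 ≤ s₆) && (decide (0 ≤ s₇) && (decide (0 ≤ s₈) && (decide (0 ≤ s₉) && (decide (0 ≤ s₁₀) &&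
        (decide (0 ≤ s₁₁) && (decide (0 ≤ s₁₂) && true)))))))))))
  | fuel + 1, n, s₁, s₂, s₃, s₄, s₅, s₆, s₇, s₈, s₉, s₁₀, s₁₁, s₁₂ =>
    let y₁ := s₁ + x (n + 1)
    let y₂ := s₂ + y₁
    let y₃ := s₃ + y₂
    let y₄ := s₄ + y₃
    let y₅ := s₅ + y₄
    let y₆ := s₆ + y₅
    let y₇ := s₇ + y₆
    let y₈ := s₈ + y₇
    let y₉ := s₉ + y₈
    let y₁₀ := s₁₀ + y₉
    let y₁₁ := s₁₁ + y₁₀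
    let y₁₂ := s₁₂ + y₁₁
    bif force1 y₁ && force1 y₂ && force1 y₃ && force1 y₄ && force1 y₅ && force1 y₆ && force1 y₇ &&
        force1 y₈ && force1 y₉ && force1 y₁₀ && force1 y₁₁ then
      match y₁₂ with
      | Int.negSucc _ => false
      | Int.ofNat _ =>
        match n + 1 with
        | 0 => false
        | n' + 1 => run12 x fuel (n' + 1) y₁ y₂ y₃ y₄ y₅ y₆ y₇ y₈ y₉ y₁₀ y₁₁ y₁₂
    else false

/-- On the values of a table, `run4` is the table walk `seqWalk` on four accumulators.
[cite: MontgomeryVaughan2007, §11.2.1 Exercise 7 (f)] -/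
theorem run4_eq_seqWalk (l : List ℤ) (m : ℕ) : ∀ (fuel n : ℕ) (s₁ s₂ s₃ s₄ : ℤ),
    run4 (FeketePolyaTable.indVal l m) fuel n s₁ s₂ s₃ s₄ = seqWalk l m fuel n [s₁, s₂, s₃, s₄] := by
  intro fuel
  induction fuel with
  | zero => intro n s₁ s₂ s₃ s₄; simp [run4, seqWalk]
  | succ fuel ih =>
    intro n s₁ s₂ s₃ s₄
    simp only [run4, seqWalk, stepAcc, force1_eq_true, Bool.true_and, cond_true, List.getLastD, ih]
    rfl

/-- On the values of a table, `run12` is `seqWalk` on twelve accumulators.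
[cite: MontgomeryVaughan2007, §11.2.1 Exercise 7 (f)] -/
theorem run12_eq_seqWalk (l : List ℤ) (m : ℕ) :
    ∀ (fuel n : ℕ) (s₁ s₂ s₃ s₄ s₅ s₆ s₇ s₈ s₉ s₁₀ s₁₁ s₁₂ : ℤ),
    run12 (FeketePolyaTable.indVal l m) fuel n s₁ s₂ s₃ s₄ s₅ s₆ s₇ s₈ s₉ s₁₀ s₁₁ s₁₂ =
      seqWalk l m fuel n [s₁, s₂, s₃, s₄, s₅, s₆, s₇, s₈, s₉, s₁₀, s₁₁, s₁₂] := by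
  intro fuel
  induction fuel with
  | zero => intro n s₁ s₂ s₃ s₄ s₅ s₆ s₇ s₈ s₉ s₁₀ s₁₁ s₁₂; simp [run12, seqWalk]
  | succ fuel ih =>
    intro n s₁ s₂ s₃ s₄ s₅ s₆ s₇ s₈ s₉ s₁₀ s₁₁ s₁₂
    simp only [run12, seqWalk, stepAcc, force1_eq_true, Bool.true_and, cond_true, List.getLastD, ih]
    rfl

/-! ### The packed period table -/

/-- Two-bit code of a value in `{0, 1, −1}`. [folklore] -/
def code (x : ℤ) : ℕ := if x = 1 then 1 else if x = -1 then 2 else 0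

/-- Decoding (`Nat.beq` tests: cheap in the kernel). [folklore] -/
def decode (c : ℕ) : ℤ := bif Nat.beq c 1 then 1 else bif Nat.beq c 2 then -1 else 0

/-- `decode (code x) = x` for `x ∈ {0, 1, −1}`. [folklore] -/
private theorem decode_code {x : ℤ} (hx : x = 0 ∨ x = 1 ∨ x = -1) : decode (code x) = x := by
  rcases hx with rfl | rfl | rfl <;> decide

/-- `code x ≤ 2`. [folklore] -/
private theorem code_le (x : ℤ) : code x ≤ 2 := by
  unfold code; split_ifs <;> omega

/-- **The packed table** `pack v q = ∑_{r<q} code(v r)·4^r`. [folklore] -/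
def pack (v : ℕ → ℤ) : ℕ → ℕ
  | 0 => 0
  | r + 1 => pack v r + code (v r) * 4 ^ r

/-- **Lookup**: `look T q n = decode ((T >>> 2(n mod q)) mod 4)` — a shift, linear in the size of `T`
(a division `T / 4^(n mod q)` is quadratic and was measured at `1 ms` per lookup for `q = 10⁴`). [folklore] -/
def look (T q n : ℕ) : ℤ := decode (T >>> (2 * (n % q)) % 4)

/-- `pack v N < 4^N`. [folklore] -/
private theorem pack_lt (v : ℕ → ℤ) : ∀ N : ℕ, pack v N < 4 ^ N
  | 0 => by simp [pack]
  | N + 1 => by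
    rw [pack, pow_succ]
    have h1 := pack_lt v N
    have h2 : code (v N) * 4 ^ N ≤ 2 * 4 ^ N := Nat.mul_le_mul_right _ (code_le _)
    omega

/-- Digit extraction: `pack v N / 4^r mod 4 = code (v r)` for `r < N`. [folklore] -/
private theorem pack_div_mod (v : ℕ → ℤ) : ∀ N r : ℕ, r < N → pack v N / 4 ^ r % 4 = code (v r)
  | 0, r, h => absurd h (Nat.not_lt_zero r)
  | N + 1, r, h => by
    have h4 : 0 < 4 ^ r := by positivity
    rw [pack]
    rcases Nat.lt_succ_iff_lt_or_eq.mp h with hr | rfl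
    · obtain ⟨e, he⟩ : ∃ e, N = r + (e + 1) := ⟨N - r - 1, by omega⟩
      have hsplit : code (v N) * 4 ^ N = code (v N) * 4 ^ e * 4 * 4 ^ r := by
        rw [he, pow_add, pow_succ]; ring
      rw [hsplit, Nat.add_mul_div_right _ _ h4, Nat.add_mul_mod_self_right]
      exact pack_div_mod v N r hr
    · rw [Nat.add_mul_div_right _ _ h4, Nat.div_eq_of_lt (pack_lt v r), zero_add]
      have := code_le (v r)
      omega

/-- **`look (pack v q) q n = v n`** for a `q`-periodic `v` with values in `{0, 1, −1}` (`q > 0`). [folklore] -/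
private theorem look_pack {v : ℕ → ℤ} {q : ℕ} (hq : 0 < q) (hper : ∀ n, v (n % q) = v n)
    (hv3 : ∀ n, v n = 0 ∨ v n = 1 ∨ v n = -1) (n : ℕ) : look (pack v q) q n = v n := by
  rw [look, Nat.shiftRight_eq_div_pow, pow_mul, show (2 : ℕ) ^ 2 = 4 from rfl,
    pack_div_mod v q (n % q) (Nat.mod_lt n hq), decode_code (hv3 _), hper]

/-! ### The certificate -/

/-- The values fed to the walk: `v` itself along the primitive modulus (`w = 1`), the packed period table
otherwise. [folklore] -/
def fpVal (v : ℕ → ℤ) (q w : ℕ) : ℕ → ℤ :=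
  match w with
  | 1 => v
  | _ => look (pack v q) q

/-- `fpVal v q w = v` pointwise. [folklore] -/
private theorem fpVal_apply {v : ℕ → ℤ} {q : ℕ} (hq : 0 < q) (hper : ∀ n, v (n % q) = v n)
    (hv3 : ∀ n, v n = 0 ∨ v n = 1 ∨ v n = -1) (w n : ℕ) : fpVal v q w n = v n := by
  unfold fpVal
  split
  · rfl
  · exact look_pack hq hper hv3 n

/-- The order actually walked: `4` if `k ≤ 4`, else `12` (positivity at order `k` over a period implies it at
every higher order over the same period). [folklore] -/
def fpOrder (k : ℕ) : ℕ := if k ≤ 4 then 4 else 12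

/-- `1 ≤ fpOrder k`. [folklore] -/
private theorem one_le_fpOrder (k : ℕ) : 1 ≤ fpOrder k := by
  unfold fpOrder; split_ifs <;> omega

/-- **The Fekete–Pólya certificate of order `k` along the induced modulus `q·w`**: the walk of order
`fpOrder k ∈ {4, 12}` over one period of `χ↑(q·w)` (values `indVal (fpVal v q w) (q·w)`) from the zero state —
the iterated sums of order `fpOrder k` are non-negative over the period and all lower orders are non-negative at
its end. [cite: MontgomeryVaughan2007, §11.2.1 Exercises 7 (f), 8] -/
def fpRun (v : ℕ → ℤ) (q w k : ℕ) : Bool :=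
  if k ≤ 4 then run4 (indVal (fpVal v q w) (q * w)) (q * w) 0 0 0 0 0
  else run12 (indVal (fpVal v q w) (q * w)) (q * w) 0 0 0 0 0 0 0 0 0 0 0 0 0

/-- Sanity checks (kernel `decide`): `d = 53` passes at order `3` along `53` and at order `2` along `106`
(packed values); `d = −67` fails at order `12` along `67`. [folklore] -/
example : fpRun (valOdd 53) 53 1 3 = true ∧ fpRun (valOdd 53) 53 2 2 = true ∧
    fpRun (valOdd 67) 67 1 12 = false := by
  decide +kernel

/-! ### Soundness: the certificate is the table check of the specification table `(List.range q).map v` -/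

/-- The specification table of `v` over one period. [folklore] -/
private def specTable (v : ℕ → ℤ) (q : ℕ) : List ℤ := (List.range q).map v

/-- Its length. [folklore] -/
private theorem length_specTable (v : ℕ → ℤ) (q : ℕ) : (specTable v q).length = q := by
  simp [specTable]

/-- Its values: `tableVal (specTable v q) n = v n` (`q > 0`, `v` `q`-periodic). [folklore] -/
private theorem tableVal_specTable {v : ℕ → ℤ} {q : ℕ} (hq : 0 < q) (hper : ∀ n, v (n % q) = v n) (n : ℕ) :
    tableVal (specTable v q) n = v n := by
  rw [tableVal, length_specTable]
  unfold specTable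
  rw [List.getD_eq_getElem?_getD, List.getElem?_map, List.getElem?_range (Nat.mod_lt n hq)]
  exact hper n

/-- **From the certificate to the table check**: `fpRun v q w k = true` gives
`seqCheck (specTable v q) (q·w) (fpOrder k) = true`. [cite: MontgomeryVaughan2007, §11.2.1 Exercise 7 (f)] -/
private theorem seqCheck_of_fpRun {v : ℕ → ℤ} {q w k : ℕ} (hq : 0 < q) (hper : ∀ n, v (n % q) = v n)
    (hv3 : ∀ n, v n = 0 ∨ v n = 1 ∨ v n = -1) (h : fpRun v q w k = true) :
    seqCheck (specTable v q) (q * w) (fpOrder k) = true := by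
  have hx : indVal (fpVal v q w) (q * w) = FeketePolyaTable.indVal (specTable v q) (q * w) := by
    funext n
    rw [indVal, FeketePolyaTable.indVal, fpVal_apply hq hper hv3, tableVal_specTable hq hper]
  unfold fpRun at h
  unfold fpOrder seqCheck
  split_ifs at h ⊢
  · rw [hx, run4_eq_seqWalk] at h
    exact h
  · rw [hx, run12_eq_seqWalk] at h
    exact h

/-- **The engine.** `χ ≠ χ₀` quadratic mod `q`, `ℜχ(n) = v(n)`, `w ≥ 1` and `fpRun v q w k`: then
`L(σ, χ) ≠ 0` for every `σ > 0` (Fekete–Pólya at order `k` for `χ↑(q·w)`, `FeketePolya1912_holds`; descent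
`L(σ, χ↑(q·w)) = L(σ, χ)·∏_{p ∣ q·w}(1 − χ(p)p^{−σ})` with positive Euler factors).
[cite: MontgomeryVaughan2007, §11.2.1 Exercises 7 (g), 8] [cite: FeketePolya1912] [cite: Chowla1935] -/
theorem lfunction_ne_zero_of_fpRun {q : ℕ} [NeZero q] (χ : DirichletCharacter ℂ q) (hχ : χ ≠ 1)
    (hquad : χ.IsQuadratic) (v : ℕ → ℤ) (hv : ∀ n : ℕ, (χ (n : ZMod q)).re = v n) {w k : ℕ} (hw : w ≠ 0)
    (h : fpRun v q w k = true) {σ : ℝ} (hσ : 0 < σ) : χ.LFunction (σ : ℂ) ≠ 0 := by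
  have hq : 0 < q := Nat.pos_of_ne_zero (NeZero.ne q)
  haveI : NeZero (q * w) := ⟨Nat.mul_ne_zero (NeZero.ne q) hw⟩
  have hper : ∀ n, v (n % q) = v n := fun n ↦ by
    have h1 := hv (n % q)
    rw [ZMod.natCast_mod, hv n] at h1
    exact_mod_cast h1.symm
  have hv3 : ∀ n, v n = 0 ∨ v n = 1 ∨ v n = -1 := fun n ↦ by
    rcases hquad (n : ZMod q) with h0 | h1 | h2
    · left; exact_mod_cast (by rw [← hv, h0, Complex.zero_re] : (v n : ℝ) = 0)
    · right; left; exact_mod_cast (by rw [← hv, h1, Complex.one_re] : (v n : ℝ) = 1)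
    · right; right
      exact_mod_cast (by rw [← hv, h2, Complex.neg_re, Complex.one_re] : (v n : ℝ) = -1)
  have hsq : χ ^ 2 = 1 := MulChar.isQuadratic_iff_sq_eq_one.mp hquad
  have hv' : ∀ n : ℕ, χ (n : ZMod q) = ((tableVal (specTable v q) n : ℤ) : ℂ) := fun n ↦ by
    rw [tableVal_specTable hq hper]
    apply Complex.ext
    · rw [hv]; norm_cast
    · rw [DirichletAbel.apply_im_eq_zero χ hsq]; norm_cast
  exact lfunction_ne_zero_of_induced_table_seq (specTable v q) χ hχ hquad (dvd_mul_right q w)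
    (length_specTable v q) hv' (one_le_fpOrder k) (seqCheck_of_fpRun hq hper hv3 h) hσ

/-! ### Per-conductor wrappers keyed on `q` (parity test or certificate) -/

/-- Primitive characters of modulus `≥ 2` are non-trivial. [folklore] -/
private theorem ne_one' {q : ℕ} [NeZero q] {χ : DirichletCharacter ℂ q} (hprim : χ.IsPrimitive)
    (hq : 2 ≤ q) : χ ≠ 1 :=
  SiegelZeroQuality.ne_one_of_isPrimitive hprim hq

/-- **Odd characters, odd conductor `q > 1`** (`χ = (·/q)`): `((q−1)/q) = +1` (no odd primitive quadratic
character) or a certificate `fpRun (valOdd q) q w k`. [cite: MontgomeryVaughan2007, §11.2.1 Exercises 7 (g), 8] -/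
theorem good_odd_of_odd_fp {q : ℕ} [NeZero q] (hq2 : q % 2 = 1) (hq1 : 1 < q) (w k : ℕ) (hw : w ≠ 0)
    (h : valOdd q (q - 1) = 1 ∨ fpRun (valOdd q) q w k = true) :
    ∀ χ : DirichletCharacter ℂ q, χ.IsQuadratic → χ.IsPrimitive → χ.Odd →
      ∀ σ : ℝ, 0 < σ → σ < 1 → χ.LFunction σ ≠ 0 := by
  intro χ hquad hprim hodd σ hσ _
  have hv := re_apply_eq_valOdd (Nat.odd_iff.mpr hq2) hq1 hprim hquad
  rcases h with hpar | hrun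
  · exact (not_odd_of_val _ hv hpar hodd).elim
  · exact lfunction_ne_zero_of_fpRun χ (ne_one' hprim hq1) hquad _ hv hw hrun hσ

/-- **Even characters, odd conductor `q > 1`**: `((q−1)/q) = −1` or a certificate.
[cite: MontgomeryVaughan2007, §11.2.1 Exercises 7 (g), 8] -/
theorem good_even_of_odd_fp {q : ℕ} [NeZero q] (hq2 : q % 2 = 1) (hq1 : 1 < q) (w k : ℕ) (hw : w ≠ 0)
    (h : valOdd q (q - 1) = -1 ∨ fpRun (valOdd q) q w k = true) :
    ∀ χ : DirichletCharacter ℂ q, χ.IsQuadratic → χ.IsPrimitive → χ.Even →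
      ∀ σ : ℝ, 0 < σ → σ < 1 → χ.LFunction σ ≠ 0 := by
  intro χ hquad hprim heven σ hσ _
  have hv := re_apply_eq_valOdd (Nat.odd_iff.mpr hq2) hq1 hprim hquad
  rcases h with hpar | hrun
  · exact (not_even_of_val _ hv hpar heven).elim
  · exact lfunction_ne_zero_of_fpRun χ (ne_one' hprim hq1) hquad _ hv hw hrun hσ

/-- **Odd characters, conductor `4m`** (`q ≡ 4 (mod 8)`, `χ = χ₋₄·(·/m)`): parity test or certificate.
[cite: MontgomeryVaughan2007, §11.2.1 Exercises 7 (g), 8] -/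
theorem good_odd_of_four_fp {q : ℕ} [NeZero q] (hq8 : q % 8 = 4) (hq1 : 4 < q) (w k : ℕ) (hw : w ≠ 0)
    (h : valFour (q / 4) (q - 1) = 1 ∨ fpRun (valFour (q / 4)) q w k = true) :
    ∀ χ : DirichletCharacter ℂ q, χ.IsQuadratic → χ.IsPrimitive → χ.Odd →
      ∀ σ : ℝ, 0 < σ → σ < 1 → χ.LFunction σ ≠ 0 := by
  obtain ⟨m, rfl⟩ : ∃ m, q = 4 * m := ⟨q / 4, by omega⟩
  haveI : NeZero m := ⟨by omega⟩
  rw [Nat.mul_div_cancel_left m (by norm_num : 0 < 4)] at h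
  intro χ hquad hprim hodd σ hσ _
  have hv := re_apply_eq_valFour (m := m) (Nat.odd_iff.mpr (by omega)) (by omega) hprim hquad
  rcases h with hpar | hrun
  · exact (not_odd_of_val _ hv hpar hodd).elim
  · exact lfunction_ne_zero_of_fpRun χ (ne_one' hprim (by omega)) hquad _ hv hw hrun hσ

/-- **Even characters, conductor `4m`**: parity test or certificate. [cite: MontgomeryVaughan2007, §11.2.1 Exercises 7 (g), 8] -/
theorem good_even_of_four_fp {q : ℕ} [NeZero q] (hq8 : q % 8 = 4) (hq1 : 4 < q) (w k : ℕ) (hw : w ≠ 0)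
    (h : valFour (q / 4) (q - 1) = -1 ∨ fpRun (valFour (q / 4)) q w k = true) :
    ∀ χ : DirichletCharacter ℂ q, χ.IsQuadratic → χ.IsPrimitive → χ.Even →
      ∀ σ : ℝ, 0 < σ → σ < 1 → χ.LFunction σ ≠ 0 := by
  obtain ⟨m, rfl⟩ : ∃ m, q = 4 * m := ⟨q / 4, by omega⟩
  haveI : NeZero m := ⟨by omega⟩
  rw [Nat.mul_div_cancel_left m (by norm_num : 0 < 4)] at h
  intro χ hquad hprim heven σ hσ _
  have hv := re_apply_eq_valFour (m := m) (Nat.odd_iff.mpr (by omega)) (by omega) hprim hquad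
  rcases h with hpar | hrun
  · exact (not_even_of_val _ hv hpar heven).elim
  · exact lfunction_ne_zero_of_fpRun χ (ne_one' hprim (by omega)) hquad _ hv hw hrun hσ

/-- **Odd characters, conductor `8m`** (`q ≡ 8 (mod 16)`; two primitive quadratic characters
`χ₋₈·(·/m)`, `χ₈·(·/m)`): for each value pattern, parity test or certificate.
[cite: MontgomeryVaughan2007, §11.2.1 Exercises 7 (g), 8] -/
theorem good_odd_of_eight_fp {q : ℕ} [NeZero q] (hq16 : q % 16 = 8) (hq1 : 8 < q) (w k : ℕ) (hw : w ≠ 0)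
    (hA : valEightA (q / 8) (q - 1) = 1 ∨ fpRun (valEightA (q / 8)) q w k = true)
    (hB : valEightB (q / 8) (q - 1) = 1 ∨ fpRun (valEightB (q / 8)) q w k = true) :
    ∀ χ : DirichletCharacter ℂ q, χ.IsQuadratic → χ.IsPrimitive → χ.Odd →
      ∀ σ : ℝ, 0 < σ → σ < 1 → χ.LFunction σ ≠ 0 := by
  obtain ⟨m, rfl⟩ : ∃ m, q = 8 * m := ⟨q / 8, by omega⟩
  haveI : NeZero m := ⟨by omega⟩
  rw [Nat.mul_div_cancel_left m (by norm_num : 0 < 8)] at hA hB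
  intro χ hquad hprim hodd σ hσ _
  rcases re_apply_eq_valEight (m := m) (Nat.odd_iff.mpr (by omega)) (by omega) hprim hquad with hv | hv
  · rcases hA with hpar | hrun
    · exact (not_odd_of_val _ hv hpar hodd).elim
    · exact lfunction_ne_zero_of_fpRun χ (ne_one' hprim (by omega)) hquad _ hv hw hrun hσ
  · rcases hB with hpar | hrun
    · exact (not_odd_of_val _ hv hpar hodd).elim
    · exact lfunction_ne_zero_of_fpRun χ (ne_one' hprim (by omega)) hquad _ hv hw hrun hσ

/-- **Even characters, conductor `8m`**: for each value pattern, parity test or certificate.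
[cite: MontgomeryVaughan2007, §11.2.1 Exercises 7 (g), 8] -/
theorem good_even_of_eight_fp {q : ℕ} [NeZero q] (hq16 : q % 16 = 8) (hq1 : 8 < q) (w k : ℕ) (hw : w ≠ 0)
    (hA : valEightA (q / 8) (q - 1) = -1 ∨ fpRun (valEightA (q / 8)) q w k = true)
    (hB : valEightB (q / 8) (q - 1) = -1 ∨ fpRun (valEightB (q / 8)) q w k = true) :
    ∀ χ : DirichletCharacter ℂ q, χ.IsQuadratic → χ.IsPrimitive → χ.Even →
      ∀ σ : ℝ, 0 < σ → σ < 1 → χ.LFunction σ ≠ 0 := by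
  obtain ⟨m, rfl⟩ : ∃ m, q = 8 * m := ⟨q / 8, by omega⟩
  haveI : NeZero m := ⟨by omega⟩
  rw [Nat.mul_div_cancel_left m (by norm_num : 0 < 8)] at hA hB
  intro χ hquad hprim heven σ hσ _
  rcases re_apply_eq_valEight (m := m) (Nat.odd_iff.mpr (by omega)) (by omega) hprim hquad with hv | hv
  · rcases hA with hpar | hrun
    · exact (not_even_of_val _ hv hpar heven).elim
    · exact lfunction_ne_zero_of_fpRun χ (ne_one' hprim (by omega)) hquad _ hv hw hrun hσ
  · rcases hB with hpar | hrun
    · exact (not_even_of_val _ hv hpar heven).elim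
    · exact lfunction_ne_zero_of_fpRun χ (ne_one' hprim (by omega)) hquad _ hv hw hrun hσ

end FeketePolyaKernel

end Literature.NumberTheory.LFunctions
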